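import Literature.MathematicalPhysics.StatisticalMechanics.ComplexSpinReflectionPositivity
import HarnessLib

/-!
# The Schwarz inequality for exponentials of reflection-split observables
# (Salmhofer–Seiler, CMP 139 (1991), Theorem 3.20 (3.70); Fröhlich–Israel–Lieb–Simon 1978)

Companion of `ComplexSpinReflectionPositivity` (Prop. 3.15 / Remark 3.16 proved there).  This file
PROVES Theorem 3.20 of Salmhofer–Seiler — the step "Using Theorem 3.20 which is applicable because
`[·]_Λ` is reflection-positive" (p. 414) of the printed proof of the infrared bound Thm. 3.21 —
for the reflection-positive brackets `[·]_Λ` of the complex spin systems on the even torus.  No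
named fact is introduced.  Honest framing: finite-volume algebra of polynomial "spin systems" at
`β = 0`; nothing about `β > 0`, the continuum, or the summit's `QCD` conjunct.

WHAT IS PRINTED (p. 412).  "Theorem 3.20.  Let `⟨·⟩` RP.  For all `A, B, C_i, D_i ∈ 𝒜_{Λ₊}`,
`|⟨e^{A + ΘB + ∑ C_i ΘD_i}⟩|² ≤ ⟨e^{A + ΘA + ∑ C_i ΘC_i}⟩ ⟨e^{B + ΘB + ∑ D_i ΘD_i}⟩` (3.70).
Proof. See [19]."  ([19] = Fröhlich–Israel–Lieb–Simon 1978; the proof there: expand the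
exponential of the crossing terms, apply the Schwarz inequality (3.54) to each term
`⟨(e^A ∏ C_{i_k}) Θ(e^B ∏ D_{i_k})⟩`, then the Cauchy–Schwarz inequality to the sums, and resum.)
In the paper the exponential series converge in the (finite-dimensional, truncated) algebra
`𝒜_Λ` of Def. 3.13.

HOW IT IS TYPED.  In the tree's rendering (`𝒜_Λ = MvPolynomial (TorusSite ν L) ℂ`, bracket =
coefficient extraction, Remark 3.2) the exponential of an observable `Q` with constant term `q`
is `e^q · e_D^{Q - q}` with the TRUNCATED exponential `e_D^P = ∑_{n ≤ D} P^n/n!` (`eT`) at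
`D = N·|Λ|` (`topDegree`): a constant-free `P` has `[R · P^n]_Λ = 0` for `n > N·|Λ|`
(`MinDegree`, `bracketC_eq_zero_of_minDegree`), so nothing is lost; for a family of exponents
`[R · ∏_j e^{Q_j}]_Λ := (∏_j e^{q_j}) [R · ∏_j e_D^{Q_j - q_j}]_Λ` (`expBracketC`) IS the limit of
the brackets of the partial sums `[R · ∏_j e_M^{Q_j}]_Λ` as `M → ∞` (`tendsto_bracketC_mul_prod_eT`,
through the binomial re-expansion `e_M^{q + T} = ∑_l es_{M-l}(q) T^l/l!`, `eT_C_add`, and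
`es_K(q) → e^q`).  The theorem is stated with `X = e^A`, `Y = e^B` as arbitrary elements of
`𝒜_{Λ₊}` and crossing exponents `w_j C_j ΘD_j`, `w_j ≥ 0` (`crossExp`):
`|[X ΘY e^{∑ w_j C_j ΘD_j}]|² ≤ [X ΘX e^{∑ w_j C_j ΘC_j}] · [Y ΘY e^{∑ w_j D_j ΘD_j}]`
(`expBracketC_schwarz`), the unnormalised form of (3.70) (the normalisation `1/Z_Λ²` cancels).

WHAT IS PROVED (0 sorry, no new `def … : Prop`).
* `MinDegree` calculus and `bracketC_eq_zero_of_minDegree` ("the bracket is blind above the top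
  degree"); `eT`, `reflect_eT`.
* `bracketC_sum_polarized_schwarz` — `|∑ w_a [U_a ΘV_a]|² ≤ (∑ w_a [U_a ΘU_a]) (∑ w_a [V_a ΘV_a])`
  from (3.54) and the finite Cauchy–Schwarz inequality; `expPartial_schwarz` — the same for the
  polarised partial sums `S_M(C,D) = ∏_j ∑_{n ≤ M} (w_j^n/n!) C_j^n Θ(D_j^n)`.
* `eT_C_add`, `bracketC_mul_prod_eT`, `tendsto_bracketC_mul_prod_eT` — the limit `M → ∞`.
* **Thm. 3.20** `expBracketC_schwarz`, and `expBracketC_diag` (the majorants are real `≥ 0`).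

## References

* M. Salmhofer, E. Seiler, *Proof of chiral symmetry breaking in strongly coupled lattice gauge
  theory*, Commun. Math. Phys. 139 (1991) 395–432, Thm. 3.20 (3.70), p. 412. [SalmhoferSeiler1991]
* J. Fröhlich, R. Israel, E. H. Lieb, B. Simon, Commun. Math. Phys. 62 (1978) 1–34 (the paper's
  [19]). [FrohlichIsraelLiebSimon1978]
-/

noncomputable section

open MvPolynomial Finset

namespace Literature.MathematicalPhysics.StatisticalMechanics

open Literature.Probability.LatticeModels (TorusSite)
open Literature.Barriers.CriticalPhenomena.NonGibbs

namespace ComplexSpin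

variable {ν L : ℕ}

/-! ### Lower degree bounds: which polynomials the bracket cannot see -/

/-- `MinDegree n P`: every monomial of `P` has total degree `≥ n` (under the coefficient extraction
of Remark 3.2 a polynomial whose monomials all have total degree `> N·|Λ|` has `[P · Φ]_Λ = 0` for
every `Φ`). [cite: SalmhoferSeiler1991, Remark 3.2] -/
def MinDegree (n : ℕ) (P : FieldAlg ν L) : Prop :=
  ∀ m ∈ P.support, n ≤ Finsupp.degree m

namespace MinDegree

/-- Every polynomial has `MinDegree 0`. [cite: SalmhoferSeiler1991, Remark 3.2] -/
theorem zero_le (P : FieldAlg ν L) : MinDegree 0 P := fun _ _ => Nat.zero_le _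

/-- Monotonicity in the bound. [cite: SalmhoferSeiler1991, Remark 3.2] -/
theorem mono {n n' : ℕ} (h : n' ≤ n) {P : FieldAlg ν L} (hP : MinDegree n P) : MinDegree n' P :=
  fun m hm => h.trans (hP m hm)

/-- Closure under addition. [cite: SalmhoferSeiler1991, Remark 3.2] -/
theorem add {n : ℕ} {P Q : FieldAlg ν L} (hP : MinDegree n P) (hQ : MinDegree n Q) :
    MinDegree n (P + Q) := by
  classical
  intro m hm
  rcases Finset.mem_union.1 (support_add hm) with h | h
  · exact hP m h
  · exact hQ m h

/-- Closure under products: the bounds add. [cite: SalmhoferSeiler1991, Remark 3.2] -/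
theorem mul {n n' : ℕ} {P Q : FieldAlg ν L} (hP : MinDegree n P) (hQ : MinDegree n' Q) :
    MinDegree (n + n') (P * Q) := by
  classical
  intro m hm
  obtain ⟨a, ha, c, hc, rfl⟩ := Finset.mem_add.1 (support_mul P Q hm)
  rw [map_add]
  exact Nat.add_le_add (hP a ha) (hQ c hc)

/-- A right factor does not lower the bound. [cite: SalmhoferSeiler1991, Remark 3.2] -/
theorem mul_right {n : ℕ} {P : FieldAlg ν L} (hP : MinDegree n P) (Q : FieldAlg ν L) :
    MinDegree n (P * Q) := by
  simpa using hP.mul (zero_le Q)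

/-- A left factor does not lower the bound. [cite: SalmhoferSeiler1991, Remark 3.2] -/
theorem mul_left {n : ℕ} {P : FieldAlg ν L} (Q : FieldAlg ν L) (hP : MinDegree n P) :
    MinDegree n (Q * P) := by
  simpa using (zero_le Q).mul hP

/-- Powers: `MinDegree n P → MinDegree (j n) (P^j)`. [cite: SalmhoferSeiler1991, Remark 3.2] -/
theorem pow {n : ℕ} {P : FieldAlg ν L} (hP : MinDegree n P) (j : ℕ) :
    MinDegree (j * n) (P ^ j) := by
  induction j with
  | zero => simpa using zero_le (1 : FieldAlg ν L)
  | succ j ih =>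
    rw [pow_succ, Nat.succ_mul]
    exact ih.mul hP

/-- Closure under finite sums. [cite: SalmhoferSeiler1991, Remark 3.2] -/
theorem sum {n : ℕ} {α : Type*} {s : Finset α} {g : α → FieldAlg ν L}
    (h : ∀ a ∈ s, MinDegree n (g a)) : MinDegree n (∑ a ∈ s, g a) := by
  classical
  induction s using Finset.induction_on with
  | empty => intro m hm; simp at hm
  | insert a s ha ih =>
    rw [Finset.sum_insert ha]
    exact (h a (Finset.mem_insert_self a s)).add
      (ih fun x hx => h x (Finset.mem_insert_of_mem hx))

/-- A polynomial without constant term has `MinDegree 1`. [cite: SalmhoferSeiler1991, Remark 3.2] -/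
theorem one_of_coeff_zero {P : FieldAlg ν L} (hP : coeff 0 P = 0) : MinDegree 1 P := by
  intro m hm
  rw [Nat.one_le_iff_ne_zero, Ne, Finsupp.degree_eq_zero_iff]
  rintro rfl
  exact (mem_support_iff.1 hm) hP

end MinDegree

/-- Coefficients below the bound vanish. [cite: SalmhoferSeiler1991, Remark 3.2] -/
theorem coeff_eq_zero_of_minDegree {n : ℕ} {P : FieldAlg ν L} (hP : MinDegree n P)
    {m : TorusSite ν L →₀ ℕ} (hm : Finsupp.degree m < n) : coeff m P = 0 := by
  by_contra h
  exact absurd (hP m (mem_support_iff.2 h)) (not_le.2 hm)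

variable [NeZero L]

/-- The total degree `N·|Λ|` of the top monomial `∏_x σ_x^N`: the bracket `[·]_Λ` sees no monomial
of larger total degree. [cite: SalmhoferSeiler1991, Remark 3.2] -/
def topDegree (ν L : ℕ) [NeZero L] (N : ℕ) : ℕ := N * Fintype.card (TorusSite ν L)

/-- `deg (N, …, N) = N·|Λ|`. [cite: SalmhoferSeiler1991, Remark 3.2] -/
theorem degree_topExponent (N : ℕ) :
    Finsupp.degree (topExponent (ν := ν) (L := L) N) = topDegree ν L N := by
  rw [Finsupp.degree_eq_sum, topDegree]
  simp [topExponent_apply', Finset.sum_const, Finset.card_univ, mul_comm]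

/-- **The bracket is blind above the top degree**: if every monomial of `P` has total degree
`> N·|Λ|` then `[P]_Λ = 0`. [cite: SalmhoferSeiler1991, Remark 3.2] -/
theorem bracketC_eq_zero_of_minDegree {N : ℕ} (f b : ℕ → ℝ) {P : FieldAlg ν L}
    (hP : MinDegree (topDegree ν L N + 1) P) : bracketC N f b P = 0 := by
  rw [bracketC]
  exact coeff_eq_zero_of_minDegree (hP.mul_right _)
    (by rw [degree_topExponent]; exact Nat.lt_succ_self _)

/-! ### Truncated exponentials -/

/-- The truncated exponential `e_D^P = ∑_{n ≤ D} P^n / n!` of an observable.  For `P` without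
constant term and `D ≥ N·|Λ|` it has the same brackets `[e_D^P · Φ]_Λ` as the exponential series
(the omitted terms have total degree `> N·|Λ|`); the exponential `e^{A + ΘB + ∑ CᵢΘDᵢ}` of
Thm. 3.20 is rendered through these. [cite: SalmhoferSeiler1991, Thm. 3.20 (3.70)] -/
def eT (D : ℕ) (P : FieldAlg ν L) : FieldAlg ν L :=
  ∑ n ∈ range (D + 1), C ((n.factorial : ℂ)⁻¹) * P ^ n

omit [NeZero L] in
/-- `Θ e_D^P = e_D^{ΘP}`. [cite: SalmhoferSeiler1991, Thm. 3.20 (3.70)] -/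
theorem reflect_eT (i : Fin ν) (k : ZMod L) (D : ℕ) (P : FieldAlg ν L) :
    reflect i k (eT D P) = eT D (reflect i k P) := by
  simp [eT, map_sum, map_mul, map_pow, reflect_C, map_inv₀, map_natCast]

/-- `e_D^P ∈ 𝒜_{Λ₊}` for `P ∈ 𝒜_{Λ₊}`. [cite: SalmhoferSeiler1991, Thm. 3.20 (3.70)] -/
theorem eT_mem_plusAlgebra {i : Fin ν} {k : ZMod L} (D : ℕ) {P : FieldAlg ν L}
    (hP : P ∈ plusAlgebra i k) : eT D P ∈ plusAlgebra i k :=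
  Subalgebra.sum_mem _ fun n _ =>
    Subalgebra.mul_mem _ (C_mem_plusAlgebra i k _) (Subalgebra.pow_mem _ hP n)

/-! ### The polarised partial exponential sums and their Schwarz inequality -/

/-- **The generalised Schwarz inequality for positive combinations**: for `U_a, V_a ∈ 𝒜_{Λ₊}` and
weights `w_a ≥ 0`, `|∑_a w_a [U_a ΘV_a]|² ≤ (∑_a w_a [U_a ΘU_a]) (∑_a w_a [V_a ΘV_a])` — the
termwise Schwarz inequality (3.54) followed by the Cauchy–Schwarz inequality for finite sums (the
mechanism of the proof of Thm. 3.20, "see [19]").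
[cite: SalmhoferSeiler1991, Thm. 3.20 (proof) with Remark 3.16 (3.54)] -/
theorem bracketC_sum_polarized_schwarz (hL : Even L) (i : Fin ν) (k : ZMod L) {N : ℕ}
    (f : ℕ → ℝ) {b : ℕ → ℝ} (hb : ∀ j ≤ N, 0 ≤ b j) {α : Type*} (s : Finset α) {w : α → ℝ}
    (hw : ∀ a ∈ s, 0 ≤ w a) {U V : α → FieldAlg ν L} (hU : ∀ a ∈ s, U a ∈ plusAlgebra i k)
    (hV : ∀ a ∈ s, V a ∈ plusAlgebra i k) :
    ‖∑ a ∈ s, (w a : ℂ) * bracketC N f b (U a * reflect i k (V a))‖ ^ 2 ≤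
      (∑ a ∈ s, (w a : ℂ) * bracketC N f b (U a * reflect i k (U a))).re *
        (∑ a ∈ s, (w a : ℂ) * bracketC N f b (V a * reflect i k (V a))).re := by
  -- termwise data
  set z : α → ℂ := fun a => bracketC N f b (U a * reflect i k (V a)) with hz
  set p : α → ℝ := fun a => (bracketC N f b (U a * reflect i k (U a))).re with hp
  set q : α → ℝ := fun a => (bracketC N f b (V a * reflect i k (V a))).re with hq
  have hpz : ∀ a ∈ s, bracketC N f b (U a * reflect i k (U a)) = (p a : ℂ) ∧ 0 ≤ p a :=
    fun a ha => bracketC_mul_reflect_nonneg hL i k f hb (hU a ha)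
  have hqz : ∀ a ∈ s, bracketC N f b (V a * reflect i k (V a)) = (q a : ℂ) ∧ 0 ≤ q a :=
    fun a ha => bracketC_mul_reflect_nonneg hL i k f hb (hV a ha)
  -- the two right-hand sums are the real sums `∑ w p`, `∑ w q`
  have hP : (∑ a ∈ s, (w a : ℂ) * bracketC N f b (U a * reflect i k (U a))).re =
      ∑ a ∈ s, w a * p a := by
    rw [Complex.re_sum]
    refine Finset.sum_congr rfl fun a ha => ?_
    rw [(hpz a ha).1, ← Complex.ofReal_mul, Complex.ofReal_re]
  have hQ : (∑ a ∈ s, (w a : ℂ) * bracketC N f b (V a * reflect i k (V a))).re =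
      ∑ a ∈ s, w a * q a := by
    rw [Complex.re_sum]
    refine Finset.sum_congr rfl fun a ha => ?_
    rw [(hqz a ha).1, ← Complex.ofReal_mul, Complex.ofReal_re]
  rw [hP, hQ]
  -- `‖∑ w z‖ ≤ ∑ w ‖z‖`
  have hnorm : ‖∑ a ∈ s, (w a : ℂ) * z a‖ ≤ ∑ a ∈ s, w a * ‖z a‖ := by
    refine (norm_sum_le _ _).trans (le_of_eq (Finset.sum_congr rfl fun a ha => ?_))
    rw [norm_mul, Complex.norm_real, Real.norm_of_nonneg (hw a ha)]
  have h0 : 0 ≤ ∑ a ∈ s, w a * ‖z a‖ := Finset.sum_nonneg fun a ha => mul_nonneg (hw a ha) (norm_nonneg _)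
  -- Cauchy–Schwarz with the termwise Schwarz inequality (3.54)
  have hcs : (∑ a ∈ s, w a * ‖z a‖) ^ 2 ≤ (∑ a ∈ s, w a * p a) * ∑ a ∈ s, w a * q a := by
    refine sum_sq_le_sum_mul_sum_of_sq_le_mul s (fun a ha => mul_nonneg (hw a ha) (hpz a ha).2)
      (fun a ha => mul_nonneg (hw a ha) (hqz a ha).2) fun a ha => ?_
    have hs := bracketC_schwarz hL i k f hb (hU a ha) (hV a ha)
    rw [Complex.normSq_eq_norm_sq] at hs
    have : (w a * ‖z a‖) ^ 2 = w a * w a * ‖z a‖ ^ 2 := by ring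
    rw [this]
    calc w a * w a * ‖z a‖ ^ 2 ≤ w a * w a * (p a * q a) :=
          mul_le_mul_of_nonneg_left hs (mul_nonneg (hw a ha) (hw a ha))
      _ = w a * p a * (w a * q a) := by ring
  calc ‖∑ a ∈ s, (w a : ℂ) * z a‖ ^ 2 ≤ (∑ a ∈ s, w a * ‖z a‖) ^ 2 :=
        pow_le_pow_left₀ (norm_nonneg _) hnorm 2
    _ ≤ _ := hcs

/-- **The polarised partial exponential sum** over a finite family of "crossing" pairs
`(C_j, D_j)` with couplings `w_j ≥ 0`:
`S_M(C, D) = ∏_j ∑_{n ≤ M} (w_j^n / n!) C_j^n Θ(D_j^n)` — the degree-`M` Taylor polynomials of the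
factors of `e^{∑_j w_j C_j ΘD_j} = ∏_j e^{w_j C_j ΘD_j}` (the term `∑ Cᵢ ΘDᵢ` of (3.70)), kept in
the polarised form `(∏ C) Θ(∏ D)` in which the Schwarz inequality (3.54) applies termwise.
[cite: SalmhoferSeiler1991, Thm. 3.20 (3.70)] -/
def expPartial (i : Fin ν) (k : ZMod L) (M : ℕ) {ι : Type*} [Fintype ι] (w : ι → ℝ)
    (C D : ι → FieldAlg ν L) : FieldAlg ν L :=
  ∏ j, ∑ n ∈ range (M + 1),
    MvPolynomial.C (((w j) ^ n / (n.factorial : ℝ) : ℝ) : ℂ) * ((C j) ^ n * reflect i k ((D j) ^ n))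

/-- The weight `∏_j w_j^{g_j} / g_j!` of the multi-index `g` in the expansion of `S_M`.
[cite: SalmhoferSeiler1991, Thm. 3.20 (proof)] -/
def expWeight {ι : Type*} [Fintype ι] (w : ι → ℝ) (g : ι → ℕ) : ℝ :=
  ∏ j, (w j) ^ (g j) / ((g j).factorial : ℝ)

omit [NeZero L] in
/-- The expansion weights are nonnegative for nonnegative couplings.
[cite: SalmhoferSeiler1991, Thm. 3.20 (proof)] -/
theorem expWeight_nonneg {ι : Type*} [Fintype ι] {w : ι → ℝ} (hw : ∀ j, 0 ≤ w j) (g : ι → ℕ) :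
    0 ≤ expWeight w g :=
  Finset.prod_nonneg fun j _ => div_nonneg (pow_nonneg (hw j) _) (Nat.cast_nonneg _)

omit [NeZero L] in
/-- **Expansion of the polarised partial sum**: `S_M(C,D) = ∑_g w_g (∏_j C_j^{g_j}) Θ(∏_j D_j^{g_j})`
over multi-indices `g : ι → {0,…,M}`. [cite: SalmhoferSeiler1991, Thm. 3.20 (proof)] -/
theorem expPartial_eq_sum (i : Fin ν) (k : ZMod L) (M : ℕ) {ι : Type*} [Fintype ι] [DecidableEq ι]
    (w : ι → ℝ) (C D : ι → FieldAlg ν L) :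
    expPartial i k M w C D = ∑ g ∈ Fintype.piFinset fun _ : ι => range (M + 1),
      MvPolynomial.C ((expWeight w g : ℝ) : ℂ) *
        ((∏ j, (C j) ^ (g j)) * reflect i k (∏ j, (D j) ^ (g j))) := by
  rw [expPartial, Finset.prod_univ_sum]
  refine Finset.sum_congr rfl fun g _ => ?_
  rw [Finset.prod_mul_distrib, Finset.prod_mul_distrib, map_prod (reflect i k), expWeight,
    Complex.ofReal_prod, map_prod MvPolynomial.C]

/-- The bracket of `R · S_M(C,D)` expanded. [cite: SalmhoferSeiler1991, Thm. 3.20 (proof)] -/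
theorem bracketC_mul_expPartial (i : Fin ν) (k : ZMod L) (M : ℕ) {ι : Type*} [Fintype ι]
    [DecidableEq ι] (w : ι → ℝ) (C D : ι → FieldAlg ν L) {N : ℕ} (f b : ℕ → ℝ)
    (X Y : FieldAlg ν L) :
    bracketC N f b (X * reflect i k Y * expPartial i k M w C D) =
      ∑ g ∈ Fintype.piFinset fun _ : ι => range (M + 1),
        ((expWeight w g : ℝ) : ℂ) *
          bracketC N f b ((X * ∏ j, (C j) ^ (g j)) * reflect i k (Y * ∏ j, (D j) ^ (g j))) := by
  rw [expPartial_eq_sum, Finset.mul_sum, bracketC, Finset.sum_mul, coeff_sum]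
  refine Finset.sum_congr rfl fun g _ => ?_
  rw [bracketC, ← coeff_C_mul]
  congr 1
  rw [map_mul (reflect i k)]
  ring

/-- Membership of the expanded observables in `𝒜_{Λ₊}`. [cite: SalmhoferSeiler1991, Thm. 3.20 (proof)] -/
theorem mul_prod_pow_mem_plusAlgebra {i : Fin ν} {k : ZMod L} {ι : Type*} [Fintype ι]
    {X : FieldAlg ν L} (hX : X ∈ plusAlgebra i k) {C : ι → FieldAlg ν L}
    (hC : ∀ j, C j ∈ plusAlgebra i k) (g : ι → ℕ) :
    (X * ∏ j, (C j) ^ (g j)) ∈ plusAlgebra i k :=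
  Subalgebra.mul_mem _ hX (Subalgebra.prod_mem _ fun j _ => Subalgebra.pow_mem _ (hC j) _)

/-- **The Schwarz inequality for the polarised partial sums** (the finite core of Thm. 3.20):
`|[X ΘY S_M(C,D)]|² ≤ [X ΘX S_M(C,C)] · [Y ΘY S_M(D,D)]` for `X, Y, C_j, D_j ∈ 𝒜_{Λ₊}` and
`w_j ≥ 0`. [cite: SalmhoferSeiler1991, Thm. 3.20 (3.70)] -/
theorem expPartial_schwarz (hL : Even L) (i : Fin ν) (k : ZMod L) {N : ℕ} (f : ℕ → ℝ)
    {b : ℕ → ℝ} (hb : ∀ j ≤ N, 0 ≤ b j) (M : ℕ) {ι : Type*} [Fintype ι] {w : ι → ℝ}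
    (hw : ∀ j, 0 ≤ w j) {X Y : FieldAlg ν L} (hX : X ∈ plusAlgebra i k)
    (hY : Y ∈ plusAlgebra i k) {C D : ι → FieldAlg ν L} (hC : ∀ j, C j ∈ plusAlgebra i k)
    (hD : ∀ j, D j ∈ plusAlgebra i k) :
    ‖bracketC N f b (X * reflect i k Y * expPartial i k M w C D)‖ ^ 2 ≤
      (bracketC N f b (X * reflect i k X * expPartial i k M w C C)).re *
        (bracketC N f b (Y * reflect i k Y * expPartial i k M w D D)).re := by
  classical
  rw [bracketC_mul_expPartial, bracketC_mul_expPartial, bracketC_mul_expPartial]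
  exact bracketC_sum_polarized_schwarz hL i k f hb _ (fun g _ => expWeight_nonneg hw g)
    (fun g _ => mul_prod_pow_mem_plusAlgebra hX hC g) (fun g _ => mul_prod_pow_mem_plusAlgebra hY hD g)

/-- The diagonal partial sums `[X ΘX S_M(C,C)]` are real and nonnegative.
[cite: SalmhoferSeiler1991, Thm. 3.20 (3.70)] -/
theorem bracketC_expPartial_diag (hL : Even L) (i : Fin ν) (k : ZMod L) {N : ℕ} (f : ℕ → ℝ)
    {b : ℕ → ℝ} (hb : ∀ j ≤ N, 0 ≤ b j) (M : ℕ) {ι : Type*} [Fintype ι] {w : ι → ℝ}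
    (hw : ∀ j, 0 ≤ w j) {X : FieldAlg ν L} (hX : X ∈ plusAlgebra i k) {C : ι → FieldAlg ν L}
    (hC : ∀ j, C j ∈ plusAlgebra i k) :
    bracketC N f b (X * reflect i k X * expPartial i k M w C C) =
        ((bracketC N f b (X * reflect i k X * expPartial i k M w C C)).re : ℂ) ∧
      0 ≤ (bracketC N f b (X * reflect i k X * expPartial i k M w C C)).re := by
  classical
  rw [bracketC_mul_expPartial]
  have h : ∀ g ∈ Fintype.piFinset (fun _ : ι => range (M + 1)),
      ((expWeight w g : ℝ) : ℂ) *
          bracketC N f b ((X * ∏ j, (C j) ^ (g j)) * reflect i k (X * ∏ j, (C j) ^ (g j))) =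
        ((expWeight w g *
          (bracketC N f b ((X * ∏ j, (C j) ^ (g j)) * reflect i k (X * ∏ j, (C j) ^ (g j)))).re : ℝ) : ℂ) ∧
      0 ≤ expWeight w g *
          (bracketC N f b ((X * ∏ j, (C j) ^ (g j)) * reflect i k (X * ∏ j, (C j) ^ (g j)))).re := by
    intro g _
    obtain ⟨h1, h2⟩ := bracketC_mul_reflect_nonneg hL i k f hb (mul_prod_pow_mem_plusAlgebra hX hC g)
    refine ⟨?_, mul_nonneg (expWeight_nonneg hw g) h2⟩
    rw [Complex.ofReal_mul, ← h1]
  constructor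
  · rw [Complex.re_sum, Complex.ofReal_sum]
    refine Finset.sum_congr rfl fun g hg => ?_
    rw [(h g hg).1, Complex.ofReal_re]
  · rw [Complex.re_sum]
    refine Finset.sum_nonneg fun g hg => ?_
    rw [(h g hg).1, Complex.ofReal_re]
    exact (h g hg).2

/-! ### The limit `M → ∞`: exponential series of observables with constant terms -/

omit [NeZero L] in
/-- The partial exponential sums of the exponential series in `ℂ`, `es_K(z) = ∑_{m ≤ K} z^m / m!`.
[cite: SalmhoferSeiler1991, Thm. 3.20 (proof)] -/
def es (K : ℕ) (z : ℂ) : ℂ := ∑ m ∈ range (K + 1), z ^ m / (m.factorial : ℂ)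

omit [NeZero L] in
/-- `es_K(z) → e^z`. [cite: SalmhoferSeiler1991, Thm. 3.20 (proof)] -/
theorem tendsto_es (z : ℂ) : Filter.Tendsto (fun K => es K z) Filter.atTop (nhds (Complex.exp z)) := by
  have h := (NormedSpace.expSeries_div_hasSum_exp z).tendsto_sum_nat
  rw [Complex.exp_eq_exp_ℂ]
  exact h.comp (Filter.tendsto_add_atTop_nat 1)

omit [NeZero L] in
/-- `es_{M-l}(z) → e^z` as `M → ∞`, for fixed `l`. [cite: SalmhoferSeiler1991, Thm. 3.20 (proof)] -/
theorem tendsto_es_sub (z : ℂ) (l : ℕ) :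
    Filter.Tendsto (fun M => es (M - l) z) Filter.atTop (nhds (Complex.exp z)) :=
  (tendsto_es z).comp (Filter.tendsto_sub_atTop_nat l)

omit [NeZero L] in
/-- **Binomial re-expansion of the truncated exponential around the constant term**:
`e_M^{z + T} = ∑_{l ≤ M} es_{M-l}(z) T^l / l!` for a constant `z` and any observable `T`.
[cite: SalmhoferSeiler1991, Thm. 3.20 (proof)] -/
theorem eT_C_add (M : ℕ) (z : ℂ) (T : FieldAlg ν L) :
    eT M (C z + T) = ∑ l ∈ range (M + 1), C (es (M - l) z * ((l.factorial : ℂ)⁻¹)) * T ^ l := by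
  unfold eT
  have hbin : ∀ n : ℕ, (C z + T) ^ n =
      ∑ l ∈ range (n + 1), T ^ l * C z ^ (n - l) * ((n.choose l : ℕ) : FieldAlg ν L) := by
    intro n; rw [add_comm]; exact add_pow T (C z) n
  simp_rw [hbin, Finset.mul_sum]
  rw [Finset.sum_comm' (t' := range (M + 1)) (s' := fun l => Ico l (M + 1))]
  · refine Finset.sum_congr rfl fun l hl => ?_
    have hlM : l ≤ M := Nat.lt_succ_iff.1 (Finset.mem_range.1 hl)
    rw [Finset.sum_Ico_eq_sum_range, show M + 1 - l = M - l + 1 by omega, es, Finset.sum_mul,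
      map_sum, Finset.sum_mul]
    refine Finset.sum_congr rfl fun m _ => ?_
    rw [Nat.add_sub_cancel_left, ← map_natCast C, ← map_pow C]
    have hchoose : (((l + m).choose l : ℕ) : ℂ) * (((l + m).factorial : ℂ)⁻¹) =
        ((l.factorial : ℂ)⁻¹) * ((m.factorial : ℂ)⁻¹) := by
      rw [Nat.cast_add_choose]
      have h1 : ((l + m).factorial : ℂ) ≠ 0 := Nat.cast_ne_zero.2 (Nat.factorial_ne_zero _)
      have h2 : (l.factorial : ℂ) ≠ 0 := Nat.cast_ne_zero.2 (Nat.factorial_ne_zero _)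
      have h3 : (m.factorial : ℂ) ≠ 0 := Nat.cast_ne_zero.2 (Nat.factorial_ne_zero _)
      field_simp
    calc C (((l + m).factorial : ℂ)⁻¹) * (T ^ l * C (z ^ m) * C (((l + m).choose l : ℕ) : ℂ))
        = C (z ^ m * ((((l + m).choose l : ℕ) : ℂ) * (((l + m).factorial : ℂ)⁻¹))) * T ^ l := by
          simp only [map_mul]; ring
      _ = C (z ^ m / (m.factorial : ℂ) * ((l.factorial : ℂ)⁻¹)) * T ^ l := by
          rw [hchoose]; congr 2; ring
  · intro n l
    simp only [Finset.mem_range, Finset.mem_Ico]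
    omega

/-- `[∑_a Φ_a]_Λ = ∑_a [Φ_a]_Λ`. [cite: SalmhoferSeiler1991, (3.1)–(3.2) and Remark 3.2] -/
theorem bracketC_sum {N : ℕ} (f b : ℕ → ℝ) {α : Type*} (s : Finset α) (Φ : α → FieldAlg ν L) :
    bracketC N f b (∑ a ∈ s, Φ a) = ∑ a ∈ s, bracketC N f b (Φ a) := by
  rw [bracketC, Finset.sum_mul, coeff_sum]
  rfl

/-- **Multilinear expansion of a product of finite sums inside the bracket**:
`[R · ∏_j ∑_{l ∈ t} a_{j,l} P_{j,l}] = ∑_g (∏_j a_{j,g_j}) [R · ∏_j P_{j,g_j}]`.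
[cite: SalmhoferSeiler1991, Thm. 3.20 (proof)] -/
theorem bracketC_mul_prod_sum {N : ℕ} (f b : ℕ → ℝ) {ι : Type*} [Fintype ι] [DecidableEq ι]
    (t : Finset ℕ) (a : ι → ℕ → ℂ) (P : ι → ℕ → FieldAlg ν L) (R : FieldAlg ν L) :
    bracketC N f b (R * ∏ j, ∑ l ∈ t, C (a j l) * P j l) =
      ∑ g ∈ Fintype.piFinset fun _ : ι => t,
        (∏ j, a j (g j)) * bracketC N f b (R * ∏ j, P j (g j)) := by
  rw [Finset.prod_univ_sum, Finset.mul_sum, bracketC_sum]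
  refine Finset.sum_congr rfl fun g _ => ?_
  rw [Finset.prod_mul_distrib, ← map_prod C, ← bracketC_C_mul]
  congr 1
  ring

/-- The constant term of an observable. [cite: SalmhoferSeiler1991, Thm. 3.20 (proof)] -/
abbrev cst (Q : FieldAlg ν L) : ℂ := coeff 0 Q

/-- The constant-free part `Q - q₀` of an observable. [cite: SalmhoferSeiler1991, Thm. 3.20 (proof)] -/
abbrev tail (Q : FieldAlg ν L) : FieldAlg ν L := Q - C (coeff 0 Q)

omit [NeZero L] in
/-- The constant-free part has no constant term. [cite: SalmhoferSeiler1991, Thm. 3.20 (proof)] -/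
theorem coeff_zero_tail (Q : FieldAlg ν L) : coeff 0 (tail Q) = 0 := by
  simp [tail]

omit [NeZero L] in
/-- `Q = q₀ + (Q - q₀)`. [cite: SalmhoferSeiler1991, Thm. 3.20 (proof)] -/
theorem C_cst_add_tail (Q : FieldAlg ν L) : C (cst Q) + tail Q = Q := by
  simp [tail, cst]

/-- Powers of constant-free parts beyond the top degree are invisible to the bracket.
[cite: SalmhoferSeiler1991, Remark 3.2] -/
theorem bracketC_mul_prod_pow_tail_eq_zero {N : ℕ} (f b : ℕ → ℝ) {ι : Type*} [Fintype ι]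
    (Q : ι → FieldAlg ν L) (R : FieldAlg ν L) {g : ι → ℕ} {j₀ : ι}
    (hg : topDegree ν L N < g j₀) :
    bracketC N f b (R * ∏ j, tail (Q j) ^ (g j)) = 0 := by
  classical
  apply bracketC_eq_zero_of_minDegree
  refine MinDegree.mul_left R ?_
  have h1 : ∀ j, MinDegree (g j) (tail (Q j) ^ (g j)) := fun j => by
    simpa using (MinDegree.one_of_coeff_zero (coeff_zero_tail (Q j))).pow (g j)
  have : MinDegree (g j₀) (∏ j, tail (Q j) ^ (g j)) := by
    rw [← Finset.mul_prod_erase Finset.univ _ (Finset.mem_univ j₀)]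
    exact (h1 j₀).mul_right _
  exact this.mono hg

/-- **The bracket of a product of truncated exponentials, expanded around the constant terms**:
for `M ≥ N·|Λ|`,
`[R ∏_j e_M^{Q_j}] = ∑_{g ≤ N·|Λ|} (∏_j es_{M-g_j}(q_j) / g_j!) [R ∏_j (Q_j - q_j)^{g_j}]`.
[cite: SalmhoferSeiler1991, Thm. 3.20 (proof)] -/
theorem bracketC_mul_prod_eT {N : ℕ} (f b : ℕ → ℝ) {ι : Type*} [Fintype ι] [DecidableEq ι]
    (Q : ι → FieldAlg ν L) (R : FieldAlg ν L) {M : ℕ} (hM : topDegree ν L N ≤ M) :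
    bracketC N f b (R * ∏ j, eT M (Q j)) =
      ∑ g ∈ Fintype.piFinset fun _ : ι => range (topDegree ν L N + 1),
        (∏ j, es (M - g j) (cst (Q j)) * (((g j).factorial : ℂ)⁻¹)) *
          bracketC N f b (R * ∏ j, tail (Q j) ^ (g j)) := by
  have h1 : (∏ j, eT M (Q j)) = ∏ j, ∑ l ∈ range (M + 1),
      C (es (M - l) (cst (Q j)) * ((l.factorial : ℂ)⁻¹)) * tail (Q j) ^ l := by
    refine Finset.prod_congr rfl fun j _ => ?_
    rw [← eT_C_add, C_cst_add_tail]
  rw [h1, bracketC_mul_prod_sum]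
  symm
  refine Finset.sum_subset (Fintype.piFinset_subset _ _ fun _ => Finset.range_subset_range.2
    (Nat.succ_le_succ hM)) fun g hg hg' => ?_
  -- a multi-index outside the small box has a coordinate above the top degree
  rw [Fintype.mem_piFinset] at hg hg'
  push Not at hg'
  obtain ⟨j₀, hj₀⟩ := hg'
  rw [Finset.mem_range, not_lt] at hj₀
  rw [bracketC_mul_prod_pow_tail_eq_zero f b Q R (Nat.lt_of_succ_le hj₀), mul_zero]

/-- **The exponential bracket** `[R · ∏_j e^{Q_j}]_Λ := (∏_j e^{q_j}) [R · ∏_j e_{N|Λ|}^{Q_j - q_j}]_Λ`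
(`q_j` the constant term of `Q_j`): the value of the convergent exponential series of the
observables `Q_j` inside the bracket (`tendsto_bracketC_mul_prod_eT`).
[cite: SalmhoferSeiler1991, Thm. 3.20 (3.70)] -/
def expBracketC (N : ℕ) (f b : ℕ → ℝ) {ι : Type*} [Fintype ι] (R : FieldAlg ν L)
    (Q : ι → FieldAlg ν L) : ℂ :=
  (∏ j, Complex.exp (cst (Q j))) * bracketC N f b (R * ∏ j, eT (topDegree ν L N) (tail (Q j)))

/-- The exponential bracket expanded over multi-indices. [cite: SalmhoferSeiler1991, Thm. 3.20 (proof)] -/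
theorem expBracketC_eq_sum {N : ℕ} (f b : ℕ → ℝ) {ι : Type*} [Fintype ι] [DecidableEq ι]
    (R : FieldAlg ν L) (Q : ι → FieldAlg ν L) :
    expBracketC N f b R Q =
      ∑ g ∈ Fintype.piFinset fun _ : ι => range (topDegree ν L N + 1),
        (∏ j, Complex.exp (cst (Q j)) * (((g j).factorial : ℂ)⁻¹)) *
          bracketC N f b (R * ∏ j, tail (Q j) ^ (g j)) := by
  rw [expBracketC]
  unfold eT
  rw [bracketC_mul_prod_sum, Finset.mul_sum]
  refine Finset.sum_congr rfl fun g _ => ?_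
  rw [← mul_assoc, ← Finset.prod_mul_distrib]

/-- **Convergence of the exponential series inside the bracket**:
`[R · ∏_j e_M^{Q_j}]_Λ → [R · ∏_j e^{Q_j}]_Λ` as `M → ∞`.
[cite: SalmhoferSeiler1991, Thm. 3.20 (proof)] -/
theorem tendsto_bracketC_mul_prod_eT {N : ℕ} (f b : ℕ → ℝ) {ι : Type*} [Fintype ι]
    (R : FieldAlg ν L) (Q : ι → FieldAlg ν L) :
    Filter.Tendsto (fun M => bracketC N f b (R * ∏ j, eT M (Q j))) Filter.atTop
      (nhds (expBracketC N f b R Q)) := by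
  classical
  rw [expBracketC_eq_sum]
  have hev : (fun M => bracketC N f b (R * ∏ j, eT M (Q j))) =ᶠ[Filter.atTop] fun M =>
      ∑ g ∈ Fintype.piFinset fun _ : ι => range (topDegree ν L N + 1),
        (∏ j, es (M - g j) (cst (Q j)) * (((g j).factorial : ℂ)⁻¹)) *
          bracketC N f b (R * ∏ j, tail (Q j) ^ (g j)) := by
    filter_upwards [Filter.eventually_ge_atTop (topDegree ν L N)] with M hM
    exact bracketC_mul_prod_eT f b Q R hM
  refine Filter.Tendsto.congr' hev.symm ?_
  refine tendsto_finsetSum _ fun g _ => ?_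
  refine Filter.Tendsto.mul_const _ ?_
  exact tendsto_finsetProd _ fun j _ => (tendsto_es_sub (cst (Q j)) (g j)).mul_const _

/-! ### Theorem 3.20: the Schwarz inequality for exponentials -/

/-- The "crossing" observables `w_j C_j ΘD_j` of (3.70) as a family of exponents.
[cite: SalmhoferSeiler1991, Thm. 3.20 (3.70)] -/
def crossExp (i : Fin ν) (k : ZMod L) {ι : Type*} (w : ι → ℝ) (C D : ι → FieldAlg ν L) :
    ι → FieldAlg ν L :=
  fun j => MvPolynomial.C ((w j : ℝ) : ℂ) * (C j * reflect i k (D j))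

omit [NeZero L] in
/-- The polarised partial sums are the truncated exponentials of the crossing observables:
`S_M(C,D) = ∏_j e_M^{w_j C_j ΘD_j}`. [cite: SalmhoferSeiler1991, Thm. 3.20 (proof)] -/
theorem expPartial_eq_prod_eT (i : Fin ν) (k : ZMod L) (M : ℕ) {ι : Type*} [Fintype ι]
    (w : ι → ℝ) (C D : ι → FieldAlg ν L) :
    expPartial i k M w C D = ∏ j, eT M (crossExp i k w C D j) := by
  unfold expPartial eT crossExp
  refine Finset.prod_congr rfl fun j _ => Finset.sum_congr rfl fun n _ => ?_
  rw [mul_pow, mul_pow, ← map_pow (reflect i k), ← map_pow MvPolynomial.C]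
  have : (((w j) ^ n / (n.factorial : ℝ) : ℝ) : ℂ) = ((n.factorial : ℂ))⁻¹ * ((w j : ℂ)) ^ n := by
    push_cast; ring
  rw [this, map_mul]
  ring

/-- **Theorem 3.20 (Salmhofer–Seiler; Fröhlich–Israel–Lieb–Simon).**  "Let `⟨·⟩` RP.  For all
`A, B, C_i, D_i ∈ 𝒜_{Λ₊}`,
`|⟨e^{A + ΘB + ∑ C_i ΘD_i}⟩|² ≤ ⟨e^{A + ΘA + ∑ C_i ΘC_i}⟩ ⟨e^{B + ΘB + ∑ D_i ΘD_i}⟩` (3.70).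
Proof. See [19]."  Here for the reflection-positive brackets `[·]_Λ` of the complex spin systems
(site data `f`, bond data `b` with `b_k ≥ 0`, any plane `(i,k)` of the even torus; the
normalisation cancels), in the form: for `X, Y, C_j, D_j ∈ 𝒜_{Λ₊}` and couplings `w_j ≥ 0`,
`|[X · ΘY · e^{∑_j w_j C_j ΘD_j}]|² ≤ [X · ΘX · e^{∑_j w_j C_j ΘC_j}] · [Y · ΘY · e^{∑_j w_j D_j ΘD_j}]`
— the printed statement with `e^A = X`, `e^B = Y` (for the exponentials of `A, B ∈ 𝒜_{Λ₊}` that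
occur, `e^A ∈ 𝒜_{Λ₊}`; the exponential series of the crossing terms is the limit of its partial sums,
`expBracketC`/`tendsto_bracketC_mul_prod_eT`).  Proof as in [19]: expand, apply (3.54) termwise,
Cauchy–Schwarz, resum, pass to the limit. [cite: SalmhoferSeiler1991, Thm. 3.20 (3.70)] -/
theorem expBracketC_schwarz (hL : Even L) (i : Fin ν) (k : ZMod L) {N : ℕ} (f : ℕ → ℝ)
    {b : ℕ → ℝ} (hb : ∀ j ≤ N, 0 ≤ b j) {ι : Type*} [Fintype ι] {w : ι → ℝ} (hw : ∀ j, 0 ≤ w j)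
    {X Y : FieldAlg ν L} (hX : X ∈ plusAlgebra i k) (hY : Y ∈ plusAlgebra i k)
    {C D : ι → FieldAlg ν L} (hC : ∀ j, C j ∈ plusAlgebra i k) (hD : ∀ j, D j ∈ plusAlgebra i k) :
    ‖expBracketC N f b (X * reflect i k Y) (crossExp i k w C D)‖ ^ 2 ≤
      (expBracketC N f b (X * reflect i k X) (crossExp i k w C C)).re *
        (expBracketC N f b (Y * reflect i k Y) (crossExp i k w D D)).re := by
  -- the three convergent sequences
  have ha := tendsto_bracketC_mul_prod_eT (N := N) f b (X * reflect i k Y) (crossExp i k w C D)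
  have hp := tendsto_bracketC_mul_prod_eT (N := N) f b (X * reflect i k X) (crossExp i k w C C)
  have hq := tendsto_bracketC_mul_prod_eT (N := N) f b (Y * reflect i k Y) (crossExp i k w D D)
  simp_rw [← expPartial_eq_prod_eT] at ha hp hq
  refine le_of_tendsto_of_tendsto' ((ha.norm).pow 2)
    (((Complex.continuous_re.tendsto _).comp hp).mul ((Complex.continuous_re.tendsto _).comp hq))
    fun M => ?_
  exact expPartial_schwarz hL i k f hb M hw hX hY hC hD

/-- The diagonal exponential brackets `[X · ΘX · e^{∑_j w_j C_j ΘC_j}]` of Thm. 3.20 are real and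
nonnegative. [cite: SalmhoferSeiler1991, Thm. 3.20 (3.70)] -/
theorem expBracketC_diag (hL : Even L) (i : Fin ν) (k : ZMod L) {N : ℕ} (f : ℕ → ℝ)
    {b : ℕ → ℝ} (hb : ∀ j ≤ N, 0 ≤ b j) {ι : Type*} [Fintype ι] {w : ι → ℝ} (hw : ∀ j, 0 ≤ w j)
    {X : FieldAlg ν L} (hX : X ∈ plusAlgebra i k) {C : ι → FieldAlg ν L}
    (hC : ∀ j, C j ∈ plusAlgebra i k) :
    expBracketC N f b (X * reflect i k X) (crossExp i k w C C) =
        ((expBracketC N f b (X * reflect i k X) (crossExp i k w C C)).re : ℂ) ∧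
      0 ≤ (expBracketC N f b (X * reflect i k X) (crossExp i k w C C)).re := by
  have hp := tendsto_bracketC_mul_prod_eT (N := N) f b (X * reflect i k X) (crossExp i k w C C)
  simp_rw [← expPartial_eq_prod_eT] at hp
  set p := expBracketC N f b (X * reflect i k X) (crossExp i k w C C) with hpdef
  have hreal : ∀ M, bracketC N f b (X * reflect i k X * expPartial i k M w C C) =
      ((bracketC N f b (X * reflect i k X * expPartial i k M w C C)).re : ℂ) :=
    fun M => (bracketC_expPartial_diag hL i k f hb M hw hX hC).1
  have hnn : ∀ M, 0 ≤ (bracketC N f b (X * reflect i k X * expPartial i k M w C C)).re :=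
    fun M => (bracketC_expPartial_diag hL i k f hb M hw hX hC).2
  have hre : Filter.Tendsto (fun M => (bracketC N f b (X * reflect i k X * expPartial i k M w C C)).re)
      Filter.atTop (nhds p.re) := (Complex.continuous_re.tendsto _).comp hp
  constructor
  · -- `p` is the limit of the real sequence `re p_M`
    have h1 : Filter.Tendsto (fun M => ((bracketC N f b (X * reflect i k X * expPartial i k M w C C)).re : ℂ))
        Filter.atTop (nhds ((p.re : ℝ) : ℂ)) := (Complex.continuous_ofReal.tendsto _).comp hre
    have h2 : Filter.Tendsto (fun M => ((bracketC N f b (X * reflect i k X * expPartial i k M w C C)).re : ℂ))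
        Filter.atTop (nhds p) := by
      refine hp.congr fun M => ?_
      exact hreal M
    exact tendsto_nhds_unique h2 h1
  · exact ge_of_tendsto' hre hnn

end ComplexSpin

end Literature.MathematicalPhysics.StatisticalMechanics

end
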